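import Summits.NavierStokesRegularity.NavierStokesRegularity.Theorems.FilamentSkeletonRssKelvinGateTools
import Summits.NavierStokesRegularity.NavierStokesRegularity.Theorems.FilamentSkeletonRssKelvinGateRotation

/-!
# Route `FilamentSkeletonRss` · crux `TransverseReductionRJ` (stmt-NavierStokesRegularity-21221) — line `kelvin_gate`,
# stubs S2/S4: DIVERGENCE STRUCTURE of the profile operator and of its linearisation (the pressure-Poisson source)

Helper file (theorems only, `--supports stmt-NavierStokesRegularity-21221 --as helper`), in the vocabulary of
`FilamentSkeletonRssKelvinGateDefs`.  HONEST FRAMING: bookkeeping for a HYPOTHETICAL filament-type RSS blow-up route;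
nothing here bears on Navier–Stokes regularity; no stub is proved here.

In a Kelvin gate (stub S2) the pressure `Q` is recovered from the divergence of the linearised equation, and in the
elliptic smoothing (stub S4) the pressure of a profile solves `ΔP = −div E_α(U) + Σ_j B_j div D_pj`.  This file computes
these divergences exactly: every LINEAR term of the rotating-Leray profile operator preserves incompressibility, and
the convective terms contribute traces of products of velocity gradients.

* `hasFDerivAt_divergence`, `IsDivFree.sum_inner_fderiv_fderiv_apply`, `IsDivFree.sum_inner_fderiv3_apply` — the
  derivative of `div V` and its vanishing to first and second order for divergence-free `V`;
* `fderiv3_symm₁₂`, `fderiv3_symm₂₃` — symmetry of the third derivative of a `C³` map (standalone);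
* `sum_inner_rotGenL_apply_comm` — `tr(J ∘ A) = tr(A ∘ J)` for the rotation generator (explicit);
* `hasFDerivAt_lerayOp` — the derivative of `y ↦ E_α(U)(y)` for `C³` `U` (explicit operator);
* **`divergence_lerayOp_of_isDivFree`** — for divergence-free `C³` `U`:
  `div E_α(U) (y) = Σ_k ⟪e_k, DU(y) DU(y) e_k⟫ = tr(DU(y)²)`
  (the rotation, scaling, and Laplacian terms are divergence-free; `div (DU[U]) = tr(DU²)`);
* **`divergence_lerayLin_of_isDivFree`** — for divergence-free `U⁰ ∈ C³`, `W ∈ C³`: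
  `div 𝓛_(α,U⁰) W (y) = 2 Σ_k ⟪e_k, DW(y) DU⁰(y) e_k⟫ = 2 tr(DW(y) DU⁰(y))`.
-/

set_option linter.dupNamespace false

noncomputable section

namespace Summit.NavierStokesRegularity.NavierStokesRegularity.Theorems.KelvinGate

open Set Function
open Literature.Analysis.FluidPDE
open scoped InnerProductSpace Laplacian ContDiff Topology

/-! ## Traces in the standard basis -/

/-- `Σ_k ⟪e_k, e₃ × (A e_k)⟫ = Σ_k ⟪e_k, A (e₃ × e_k)⟫` (`tr(J A) = tr(A J)` for the rotation generator). -/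
theorem sum_inner_rotGenL_apply_comm (A : EuclideanSpace ℝ (Fin 3) →L[ℝ] EuclideanSpace ℝ (Fin 3)) :
    ∑ k : Fin 3, ⟪EuclideanSpace.basisFun (Fin 3) ℝ k, rotGenL (A (EuclideanSpace.basisFun (Fin 3) ℝ k))⟫_ℝ =
      ∑ k : Fin 3, ⟪EuclideanSpace.basisFun (Fin 3) ℝ k, A (rotGenL (EuclideanSpace.basisFun (Fin 3) ℝ k))⟫_ℝ := by
  have hskew : ∀ a w : EuclideanSpace ℝ (Fin 3), ⟪a, rotGenL w⟫_ℝ = -⟪rotGenL a, w⟫_ℝ := fun a w => by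
    rw [rotGenL_apply, rotGenL_apply, inner_rotGen_left, real_inner_comm, inner_rotGen_left]; ring
  simp only [Fin.sum_univ_three, hskew, rotGenL_basisFun_zero, rotGenL_basisFun_one, rotGenL_basisFun_two, map_neg,
    map_zero, inner_zero_right, inner_neg_right, inner_neg_left, neg_neg, inner_zero_left, neg_zero, add_zero]
  ring

/-- `Σ_k ⟪e_k, A (B e_k)⟫ = Σ_k ⟪e_k, B (A e_k)⟫` (`tr(AB) = tr(BA)`). -/
theorem sum_inner_comp_comm (A B : EuclideanSpace ℝ (Fin 3) →L[ℝ] EuclideanSpace ℝ (Fin 3)) :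
    ∑ k : Fin 3, ⟪EuclideanSpace.basisFun (Fin 3) ℝ k, A (B (EuclideanSpace.basisFun (Fin 3) ℝ k))⟫_ℝ =
      ∑ k : Fin 3, ⟪EuclideanSpace.basisFun (Fin 3) ℝ k, B (A (EuclideanSpace.basisFun (Fin 3) ℝ k))⟫_ℝ := by
  have h1 := LinearMap.trace_eq_sum_inner ((A : EuclideanSpace ℝ (Fin 3) →ₗ[ℝ] EuclideanSpace ℝ (Fin 3)) *
    (B : EuclideanSpace ℝ (Fin 3) →ₗ[ℝ] EuclideanSpace ℝ (Fin 3))) (EuclideanSpace.basisFun (Fin 3) ℝ)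
  have h2 := LinearMap.trace_eq_sum_inner ((B : EuclideanSpace ℝ (Fin 3) →ₗ[ℝ] EuclideanSpace ℝ (Fin 3)) *
    (A : EuclideanSpace ℝ (Fin 3) →ₗ[ℝ] EuclideanSpace ℝ (Fin 3))) (EuclideanSpace.basisFun (Fin 3) ℝ)
  rw [LinearMap.trace_mul_comm] at h1
  rw [h1] at h2
  simpa only [Module.End.mul_apply, ContinuousLinearMap.coe_coe] using h2

/-! ## Derivatives of the divergence; symmetric third derivatives -/

/-- The derivative of the divergence of a `C²` field: `D(div V)(y) h = Σ_k ⟪e_k, D²V(y)[h] e_k⟫`. -/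
theorem hasFDerivAt_divergence {V : EuclideanSpace ℝ (Fin 3) → EuclideanSpace ℝ (Fin 3)} (hV : ContDiff ℝ 2 V)
    (y : EuclideanSpace ℝ (Fin 3)) :
    HasFDerivAt (VectorCalculus.divergence V)
      (∑ k : Fin 3, (innerSL ℝ (EuclideanSpace.basisFun (Fin 3) ℝ k)).comp
        ((fderiv ℝ (fderiv ℝ V) y).flip (EuclideanSpace.basisFun (Fin 3) ℝ k))) y := by
  have e : VectorCalculus.divergence V = fun z => ∑ k : Fin 3,
      ⟪EuclideanSpace.basisFun (Fin 3) ℝ k, fderiv ℝ V z (EuclideanSpace.basisFun (Fin 3) ℝ k)⟫_ℝ :=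
    funext fun z => divergence_eq_sum_inner_fderiv _ V z
  rw [e]
  have hPd : HasFDerivAt (fderiv ℝ V) (fderiv ℝ (fderiv ℝ V) y) y :=
    ((hV.fderiv_right (m := 1) (by norm_num)).differentiable (by norm_num) y).hasFDerivAt
  refine HasFDerivAt.fun_sum fun k _ => ?_
  have h1 := hasFDerivAt_clm_apply_const hPd (EuclideanSpace.basisFun (Fin 3) ℝ k)
  have h2 := (innerSL ℝ (EuclideanSpace.basisFun (Fin 3) ℝ k)).hasFDerivAt.comp y h1
  simpa only [Function.comp_def, innerSL_apply_apply] using h2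

/-- For a divergence-free `C²` field, `Σ_k ⟪e_k, D²V(y)[h] e_k⟫ = 0` for every `h` (first derivative of `div V ≡ 0`). -/
theorem IsDivFree.sum_inner_fderiv_fderiv_apply {V : EuclideanSpace ℝ (Fin 3) → EuclideanSpace ℝ (Fin 3)}
    (hV : ContDiff ℝ 2 V) (hdiv : VectorCalculus.IsDivFree V) (y h : EuclideanSpace ℝ (Fin 3)) :
    ∑ k : Fin 3, ⟪EuclideanSpace.basisFun (Fin 3) ℝ k, fderiv ℝ (fderiv ℝ V) y h (EuclideanSpace.basisFun (Fin 3) ℝ k)⟫_ℝ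
      = 0 := by
  have h0 : VectorCalculus.divergence V = fun _ => (0:ℝ) := funext fun x => hdiv x
  have hd := hasFDerivAt_divergence hV y
  rw [h0] at hd
  have huniq := hd.unique (hasFDerivAt_const (0:ℝ) y)
  have := congrArg (fun L : EuclideanSpace ℝ (Fin 3) →L[ℝ] ℝ => L h) huniq
  simpa only [FunLike.coe_sum, Finset.sum_apply, ContinuousLinearMap.coe_comp, Function.comp_apply,
    ContinuousLinearMap.flip_apply, innerSL_apply_apply, _root_.zero_apply] using this

/-- For a divergence-free `C³` field, `Σ_k ⟪e_k, D³V(y)[v][h] e_k⟫ = 0` for all `v, h` (second derivative of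
`div V ≡ 0`). -/
theorem IsDivFree.sum_inner_fderiv3_apply {V : EuclideanSpace ℝ (Fin 3) → EuclideanSpace ℝ (Fin 3)}
    (hV : ContDiff ℝ 3 V) (hdiv : VectorCalculus.IsDivFree V) (y v h : EuclideanSpace ℝ (Fin 3)) :
    ∑ k : Fin 3, ⟪EuclideanSpace.basisFun (Fin 3) ℝ k,
      fderiv ℝ (fderiv ℝ (fderiv ℝ V)) y v h (EuclideanSpace.basisFun (Fin 3) ℝ k)⟫_ℝ = 0 := by
  -- the function `z ↦ Σ_k ⟪e_k, D²V(z)[h] e_k⟫` vanishes identically; differentiate it along `v`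
  have hV2 : ContDiff ℝ 2 V := hV.of_le (by norm_num)
  have hzero : (fun z => ∑ k : Fin 3, ⟪EuclideanSpace.basisFun (Fin 3) ℝ k,
      fderiv ℝ (fderiv ℝ V) z h (EuclideanSpace.basisFun (Fin 3) ℝ k)⟫_ℝ) = fun _ => (0:ℝ) :=
    funext fun z => IsDivFree.sum_inner_fderiv_fderiv_apply hV2 hdiv z h
  have hQc : ContDiff ℝ 1 (fderiv ℝ (fderiv ℝ V)) :=
    (hV.fderiv_right (m := 2) (by norm_num)).fderiv_right (m := 1) (by norm_num)
  have hQd : HasFDerivAt (fderiv ℝ (fderiv ℝ V)) (fderiv ℝ (fderiv ℝ (fderiv ℝ V)) y) y :=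
    (hQc.differentiable (by norm_num) y).hasFDerivAt
  have hd : HasFDerivAt (fun z => ∑ k : Fin 3, ⟪EuclideanSpace.basisFun (Fin 3) ℝ k,
      fderiv ℝ (fderiv ℝ V) z h (EuclideanSpace.basisFun (Fin 3) ℝ k)⟫_ℝ)
      (∑ k : Fin 3, (innerSL ℝ (EuclideanSpace.basisFun (Fin 3) ℝ k)).comp
        (((fderiv ℝ (fderiv ℝ (fderiv ℝ V)) y).flip h).flip (EuclideanSpace.basisFun (Fin 3) ℝ k))) y := by
    refine HasFDerivAt.fun_sum fun k _ => ?_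
    have h1 := hasFDerivAt_clm_apply_const (hasFDerivAt_clm_apply_const hQd h) (EuclideanSpace.basisFun (Fin 3) ℝ k)
    have h2 := (innerSL ℝ (EuclideanSpace.basisFun (Fin 3) ℝ k)).hasFDerivAt.comp y h1
    simpa only [Function.comp_def, innerSL_apply_apply] using h2
  rw [hzero] at hd
  have huniq := hd.unique (hasFDerivAt_const (0:ℝ) y)
  have := congrArg (fun L : EuclideanSpace ℝ (Fin 3) →L[ℝ] ℝ => L v) huniq
  simpa only [FunLike.coe_sum, Finset.sum_apply, ContinuousLinearMap.coe_comp, Function.comp_apply,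
    ContinuousLinearMap.flip_apply, innerSL_apply_apply, _root_.zero_apply] using this

/-- Symmetry of the third derivative in its first two slots, for a `C³` map. -/
theorem fderiv3_symm₁₂ {F : Type*} [NormedAddCommGroup F] [NormedSpace ℝ F] {V : EuclideanSpace ℝ (Fin 3) → F}
    (hV : ContDiff ℝ 3 V) (y v w : EuclideanSpace ℝ (Fin 3)) :
    fderiv ℝ (fderiv ℝ (fderiv ℝ V)) y v w = fderiv ℝ (fderiv ℝ (fderiv ℝ V)) y w v :=
  (((hV.fderiv_right (m := 2) (by norm_num)).contDiffAt (x := y)).isSymmSndFDerivAt (by simp)).eq v w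

/-- Symmetry of the third derivative in its last two slots, for a `C³` map. -/
theorem fderiv3_symm₂₃ {F : Type*} [NormedAddCommGroup F] [NormedSpace ℝ F] {V : EuclideanSpace ℝ (Fin 3) → F}
    (hV : ContDiff ℝ 3 V) (y h v w : EuclideanSpace ℝ (Fin 3)) :
    fderiv ℝ (fderiv ℝ (fderiv ℝ V)) y h v w = fderiv ℝ (fderiv ℝ (fderiv ℝ V)) y h w v := by
  have symm2 : ∀ z, fderiv ℝ (fderiv ℝ V) z v w = fderiv ℝ (fderiv ℝ V) z w v := fun z =>
    ((hV.contDiffAt (x := z)).isSymmSndFDerivAt (by rw [minSmoothness_of_isRCLikeNormedField]; norm_num)).eq v w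
  have hQc : ContDiff ℝ 1 (fderiv ℝ (fderiv ℝ V)) :=
    (hV.fderiv_right (m := 2) (by norm_num)).fderiv_right (m := 1) (by norm_num)
  have hQd : HasFDerivAt (fderiv ℝ (fderiv ℝ V)) (fderiv ℝ (fderiv ℝ (fderiv ℝ V)) y) y :=
    (hQc.differentiable (by norm_num) y).hasFDerivAt
  have e : (fun z => fderiv ℝ (fderiv ℝ V) z v w) = fun z => fderiv ℝ (fderiv ℝ V) z w v := funext symm2
  have d1 : HasFDerivAt (fun z => fderiv ℝ (fderiv ℝ V) z v w)
      (((fderiv ℝ (fderiv ℝ (fderiv ℝ V)) y).flip v).flip w) y :=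
    hasFDerivAt_clm_apply_const (hasFDerivAt_clm_apply_const hQd v) w
  have d2 : HasFDerivAt (fun z => fderiv ℝ (fderiv ℝ V) z w v)
      (((fderiv ℝ (fderiv ℝ (fderiv ℝ V)) y).flip w).flip v) y :=
    hasFDerivAt_clm_apply_const (hasFDerivAt_clm_apply_const hQd w) v
  rw [e] at d1
  have := congrArg (fun L => L h) (d1.unique d2)
  simpa only [ContinuousLinearMap.flip_apply] using this

/-! ## The derivative of the profile operator -/

/-- **Derivative of `y ↦ E_α(U)(y)`** for a `C³` field `U` (explicit operator; `J = rotGenL`, `P = DU`, `Q = D²U`,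
`T = D³U`): `D(E_α U)(y) = α(J∘P(y) − P(y)∘J − Q(y)[·](Jy)) + ½P(y) + ½(P(y) + Q(y)[·](y)) − Σ_i T(y)[·](e_i)(e_i)
+ (P(y)∘P(y) + Q(y)[·](U y))`. -/
theorem hasFDerivAt_lerayOp (α : ℝ) {U : EuclideanSpace ℝ (Fin 3) → EuclideanSpace ℝ (Fin 3)} (hU : ContDiff ℝ 3 U)
    (y : EuclideanSpace ℝ (Fin 3)) :
    HasFDerivAt (lerayOp α U)
      (α • (rotGenL.comp (fderiv ℝ U y) - ((fderiv ℝ U y).comp rotGenL + (fderiv ℝ (fderiv ℝ U) y).flip (rotGenL y))) +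
        (1/2:ℝ) • fderiv ℝ U y +
        (1/2:ℝ) • ((fderiv ℝ U y).comp (ContinuousLinearMap.id ℝ _) + (fderiv ℝ (fderiv ℝ U) y).flip y) -
        (∑ i : Fin 3, ((fderiv ℝ (fderiv ℝ (fderiv ℝ U)) y).flip (EuclideanSpace.basisFun (Fin 3) ℝ i)).flip
          (EuclideanSpace.basisFun (Fin 3) ℝ i)) +
        ((fderiv ℝ U y).comp (fderiv ℝ U y) + (fderiv ℝ (fderiv ℝ U) y).flip (U y))) y := by
  have e : lerayOp α U = fun z => α • (rotGenL (U z) - fderiv ℝ U z (rotGenL z)) + (1/2:ℝ) • U z +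
      (1/2:ℝ) • fderiv ℝ U z z - (fun z => ∑ i : Fin 3, fderiv ℝ (fderiv ℝ U) z (EuclideanSpace.basisFun (Fin 3) ℝ i)
        (EuclideanSpace.basisFun (Fin 3) ℝ i)) z + fderiv ℝ U z (U z) := by
    funext z
    simp only [lerayOp, cross_single_two_eq_rotGenL]
    rw [laplacian_eq_sum_fderiv_fderiv U]
  rw [e]
  have hPc : ContDiff ℝ 2 (fderiv ℝ U) := hU.fderiv_right (by norm_num)
  have hQc : ContDiff ℝ 1 (fderiv ℝ (fderiv ℝ U)) := hPc.fderiv_right (by norm_num)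
  have hUd : HasFDerivAt U (fderiv ℝ U y) y := (hU.differentiable (by norm_num) y).hasFDerivAt
  have hPd : HasFDerivAt (fderiv ℝ U) (fderiv ℝ (fderiv ℝ U) y) y := (hPc.differentiable (by norm_num) y).hasFDerivAt
  have hQd : HasFDerivAt (fderiv ℝ (fderiv ℝ U)) (fderiv ℝ (fderiv ℝ (fderiv ℝ U)) y) y :=
    (hQc.differentiable (by norm_num) y).hasFDerivAt
  have hJd : HasFDerivAt (fun z : EuclideanSpace ℝ (Fin 3) => rotGenL z) rotGenL y := rotGenL.hasFDerivAt
  have hRUd : HasFDerivAt (fun w => rotGenL (U w) - fderiv ℝ U w (rotGenL w))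
      (rotGenL.comp (fderiv ℝ U y) - ((fderiv ℝ U y).comp rotGenL + (fderiv ℝ (fderiv ℝ U) y).flip (rotGenL y))) y :=
    (rotGenL.hasFDerivAt.comp y hUd).sub (hPd.clm_apply hJd)
  have hΔUd : HasFDerivAt (fun z => ∑ i : Fin 3, fderiv ℝ (fderiv ℝ U) z (EuclideanSpace.basisFun (Fin 3) ℝ i)
      (EuclideanSpace.basisFun (Fin 3) ℝ i))
      (∑ i : Fin 3, ((fderiv ℝ (fderiv ℝ (fderiv ℝ U)) y).flip (EuclideanSpace.basisFun (Fin 3) ℝ i)).flip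
        (EuclideanSpace.basisFun (Fin 3) ℝ i)) y :=
    HasFDerivAt.fun_sum fun i _ => hasFDerivAt_clm_apply_const (hasFDerivAt_clm_apply_const hQd _) _
  exact ((((hRUd.const_smul α).add (hUd.const_smul (1/2:ℝ))).add
    ((hPd.clm_apply ((ContinuousLinearMap.id ℝ _).hasFDerivAt)).const_smul (1/2:ℝ))).sub hΔUd)
    |>.add (hPd.clm_apply hUd)

/-! ## Divergence of the profile operator and of its linearisation -/

/-- **`div E_α(U) = tr(DU²)` for divergence-free `C³` `U`.**  Every linear term of the rotating-Leray profile operator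
preserves incompressibility (`div 𝓡U = −D(div U)[e₃×y] = 0`, `div(½U + ½DU[y]) = div U + ½D(div U)[y] = 0`,
`div ΔU = Δ div U = 0`), and `div(DU[U]) = D(div U)[U] + tr(DU²) = tr(DU²)`; written in the standard basis,
`div E_α(U)(y) = Σ_k ⟪e_k, DU(y)(DU(y) e_k)⟫`.  (Pressure-Poisson source of stub S4: `ΔP = −tr(DU²) + Σ_j B_j div D_pj`.) -/
theorem divergence_lerayOp_of_isDivFree (α : ℝ) {U : EuclideanSpace ℝ (Fin 3) → EuclideanSpace ℝ (Fin 3)}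
    (hU : ContDiff ℝ 3 U) (hdiv : VectorCalculus.IsDivFree U) (y : EuclideanSpace ℝ (Fin 3)) :
    VectorCalculus.divergence (lerayOp α U) y =
      ∑ k : Fin 3, ⟪EuclideanSpace.basisFun (Fin 3) ℝ k, fderiv ℝ U y (fderiv ℝ U y (EuclideanSpace.basisFun (Fin 3) ℝ k))⟫_ℝ := by
  set b := EuclideanSpace.basisFun (Fin 3) ℝ with hb
  set P := fderiv ℝ U y with hP
  set Q := fderiv ℝ (fderiv ℝ U) y with hQ
  set T := fderiv ℝ (fderiv ℝ (fderiv ℝ U)) y with hT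
  have hU2 : ContDiff ℝ 2 U := hU.of_le (by norm_num)
  have symm2 : ∀ v w, Q v w = Q w v := fun v w =>
    ((hU.contDiffAt (x := y)).isSymmSndFDerivAt (by rw [minSmoothness_of_isRCLikeNormedField]; norm_num)).eq v w
  -- the four vanishing facts
  have F0 : ∑ k : Fin 3, ⟪b k, P (b k)⟫_ℝ = 0 := by
    rw [hP, ← divergence_eq_sum_inner_fderiv b U y]; exact hdiv y
  have F1 : ∀ h, ∑ k : Fin 3, ⟪b k, Q (b k) h⟫_ℝ = 0 := fun h => by
    simp only [symm2 (b _) h]; exact IsDivFree.sum_inner_fderiv_fderiv_apply hU2 hdiv y h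
  have F2 : ∑ k : Fin 3, ⟪b k, ∑ i : Fin 3, T (b k) (b i) (b i)⟫_ℝ = 0 := by
    have e3 : ∀ k i : Fin 3, T (b k) (b i) (b i) = T (b i) (b i) (b k) := fun k i => by
      rw [hT, fderiv3_symm₁₂ hU y (b k) (b i), fderiv3_symm₂₃ hU y (b i) (b k) (b i)]
    have h0 : ∀ i : Fin 3, ∑ k : Fin 3, ⟪b k, T (b i) (b i) (b k)⟫_ℝ = 0 := fun i => by
      have := IsDivFree.sum_inner_fderiv3_apply hU hdiv y (b i) (b i)
      rw [← hb, ← hT] at this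
      exact this
    calc ∑ k : Fin 3, ⟪b k, ∑ i : Fin 3, T (b k) (b i) (b i)⟫_ℝ
        = ∑ k : Fin 3, ∑ i : Fin 3, ⟪b k, T (b i) (b i) (b k)⟫_ℝ :=
          Finset.sum_congr rfl fun k _ => by rw [inner_sum]; exact Finset.sum_congr rfl fun i _ => by rw [e3]
      _ = ∑ i : Fin 3, ∑ k : Fin 3, ⟪b k, T (b i) (b i) (b k)⟫_ℝ := Finset.sum_comm
      _ = 0 := Finset.sum_eq_zero fun i _ => h0 i
  have FJ : ∑ k : Fin 3, ⟪b k, rotGenL (P (b k))⟫_ℝ = ∑ k : Fin 3, ⟪b k, P (rotGenL (b k))⟫_ℝ := by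
    have := sum_inner_rotGenL_apply_comm P
    rw [← hb] at this
    exact this
  rw [divergence_eq_sum_inner_fderiv b, (hasFDerivAt_lerayOp α hU y).fderiv]
  simp only [← hb, ← hP, ← hQ, ← hT, _root_.add_apply, _root_.sub_apply,
    _root_.smul_apply, ContinuousLinearMap.comp_apply, ContinuousLinearMap.flip_apply,
    ContinuousLinearMap.coe_id', id, FunLike.coe_sum, Finset.sum_apply,
    inner_add_right, inner_sub_right, real_inner_smul_right, Finset.sum_add_distrib, Finset.sum_sub_distrib,
    ← Finset.mul_sum, F0, F1, F2]
  rw [FJ]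
  ring

/-- **`div 𝓛_(α,U⁰) W = 2 tr(DW DU⁰)` for divergence-free `C³` fields `U⁰, W`.**  The linear terms of the
linearisation preserve incompressibility and `div(DW[U⁰] + DU⁰[W]) = tr(DW DU⁰) + tr(DU⁰ DW) = 2 tr(DW DU⁰)`; in the
standard basis, `div 𝓛W (y) = 2 Σ_k ⟪e_k, DW(y)(DU⁰(y) e_k)⟫`.  (Pressure-Poisson source of a Kelvin gate, stub S2:
`ΔQ = div F + Σ_j b_j div D_pj − 2 tr(DW DU⁰)`.) -/
theorem divergence_lerayLin_of_isDivFree (α : ℝ) {U0 W : EuclideanSpace ℝ (Fin 3) → EuclideanSpace ℝ (Fin 3)}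
    (hU : ContDiff ℝ 3 U0) (hW : ContDiff ℝ 3 W) (hdivU : VectorCalculus.IsDivFree U0)
    (hdivW : VectorCalculus.IsDivFree W) (y : EuclideanSpace ℝ (Fin 3)) :
    VectorCalculus.divergence (lerayLin α U0 W) y =
      2 * ∑ k : Fin 3, ⟪EuclideanSpace.basisFun (Fin 3) ℝ k,
        fderiv ℝ W y (fderiv ℝ U0 y (EuclideanSpace.basisFun (Fin 3) ℝ k))⟫_ℝ := by
  -- `𝓛 W = E_α(U⁰ + W) − E_α(U⁰) − DW[W]` pointwise (`lerayOp_formula_add`), and `U⁰ + W` is divergence free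
  have hsum3 : ContDiff ℝ 3 (fun z => U0 z + W z) := hU.add hW
  have hdivS : VectorCalculus.IsDivFree (fun z => U0 z + W z) := by
    intro x
    have h1 := hdivU x
    have h2 := hdivW x
    simp only [VectorCalculus.divergence] at h1 h2 ⊢
    rw [fderiv_fun_add (hU.differentiable (by norm_num) x) (hW.differentiable (by norm_num) x),
      ContinuousLinearMap.toLinearMap_add, map_add, h1, h2, add_zero]
  have e : lerayLin α U0 W = fun z => lerayOp α (fun x => U0 x + W x) z - lerayOp α U0 z - fderiv ℝ W z (W z) := by
    funext z
    rw [lerayOp_add_eq α U0 W z (hU.contDiffAt.of_le (by norm_num)) (hW.contDiffAt.of_le (by norm_num))]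
    abel
  -- divergence of the convective remainder `DW[W]`: `tr(DW²)`
  have hconv : ∀ {V : EuclideanSpace ℝ (Fin 3) → EuclideanSpace ℝ (Fin 3)}, ContDiff ℝ 3 V → VectorCalculus.IsDivFree V →
      VectorCalculus.divergence (fun z => fderiv ℝ V z (V z)) y =
        ∑ k : Fin 3, ⟪EuclideanSpace.basisFun (Fin 3) ℝ k,
          fderiv ℝ V y (fderiv ℝ V y (EuclideanSpace.basisFun (Fin 3) ℝ k))⟫_ℝ := by
    intro V hV hdV
    have hVd : HasFDerivAt V (fderiv ℝ V y) y := (hV.differentiable (by norm_num) y).hasFDerivAt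
    have hPd : HasFDerivAt (fderiv ℝ V) (fderiv ℝ (fderiv ℝ V) y) y :=
      ((hV.fderiv_right (m := 2) (by norm_num)).differentiable (by norm_num) y).hasFDerivAt
    have symmV : ∀ v w, fderiv ℝ (fderiv ℝ V) y v w = fderiv ℝ (fderiv ℝ V) y w v := fun v w =>
      ((hV.contDiffAt (x := y)).isSymmSndFDerivAt (by rw [minSmoothness_of_isRCLikeNormedField]; norm_num)).eq v w
    rw [divergence_eq_sum_inner_fderiv (EuclideanSpace.basisFun (Fin 3) ℝ), (hPd.clm_apply hVd).fderiv]
    simp only [_root_.add_apply, ContinuousLinearMap.comp_apply, ContinuousLinearMap.flip_apply,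
      inner_add_right, Finset.sum_add_distrib, symmV (EuclideanSpace.basisFun (Fin 3) ℝ _) (V y),
      IsDivFree.sum_inner_fderiv_fderiv_apply (hV.of_le (by norm_num)) hdV y (V y), add_zero]
  -- differentiability of the three pieces at `y`
  have hd1 : DifferentiableAt ℝ (lerayOp α (fun x => U0 x + W x)) y := (hasFDerivAt_lerayOp α hsum3 y).differentiableAt
  have hd2 : DifferentiableAt ℝ (lerayOp α U0) y := (hasFDerivAt_lerayOp α hU y).differentiableAt
  have hd3 : DifferentiableAt ℝ (fun z => fderiv ℝ W z (W z)) y :=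
    (((hW.fderiv_right (m := 2) (by norm_num)).differentiable (by norm_num) y).hasFDerivAt.clm_apply
      ((hW.differentiable (by norm_num) y).hasFDerivAt)).differentiableAt
  -- divergence is additive at differentiable points
  have hdivsub : VectorCalculus.divergence (lerayLin α U0 W) y =
      VectorCalculus.divergence (lerayOp α (fun x => U0 x + W x)) y - VectorCalculus.divergence (lerayOp α U0) y -
        VectorCalculus.divergence (fun z => fderiv ℝ W z (W z)) y := by
    rw [e]
    simp only [VectorCalculus.divergence]
    rw [fderiv_fun_sub (hd1.fun_sub hd2) hd3, fderiv_fun_sub hd1 hd2]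
    simp only [ContinuousLinearMap.toLinearMap_sub, map_sub]
  rw [hdivsub, divergence_lerayOp_of_isDivFree α hsum3 hdivS y, divergence_lerayOp_of_isDivFree α hU hdivU y,
    hconv hW hdivW, fderiv_fun_add (hU.differentiable (by norm_num) y) (hW.differentiable (by norm_num) y)]
  simp only [_root_.add_apply, map_add, inner_add_right, Finset.sum_add_distrib,
    sum_inner_comp_comm (fderiv ℝ U0 y) (fderiv ℝ W y)]
  ring

end Summit.NavierStokesRegularity.NavierStokesRegularity.Theorems.KelvinGate
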